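import Literature.AlgebraicGeometry.AbelianSchemes.LevelStructureTwist
import Literature.AlgebraicGeometry.AbelianSchemes.LevelSectionsSubgroup
import Literature.AlgebraicGeometry.AbelianSchemes.AbelianSchemeOverSectionPow
import Literature.AlgebraicGeometry.AbelianSchemes.TorsionPointsLocallyConstant
import Literature.AlgebraicGeometry.AbelianSchemes.LevelStructureTwistChangeLevel
import Literature.AlgebraicGeometry.Morphisms.SectionEqualizerClopen
import Mathlib.LinearAlgebra.Matrix.ToLin
import Mathlib.Algebra.Module.ZMod
import HarnessLib

/-!
# Two level structures differ by a LOCALLY CONSTANT matrix of `GL_{2g}(ℤ/N)`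
# ([MFK94] Ch. 7 §2 Def. 7.1, §3 pp. 139–140 «`Γ_n` acts on `ℋ_{g,d,n}`»; [GW II] Prop. 27.188)

Topic `AlgebraicGeometry/AbelianSchemes`; namespace `Literature.AlgebraicGeometry.AbelianSchemes.AbelianSchemeOver.LevelStructure`.
THEOREMS ONLY (no definition, no named fact, no instance, no notation, no `sorry`; net Literature debt 0).  Cell
hodgecm-mathlib (D-0151), F-DAG price sheet leaf F-10 (b) «`classify` for the quotient `M/Γ`», brick (b1): on the kernel
pair `T″ = T′ ×_T T′` of a refining cover the two level-`NK` refinements of one level-`N` structure differ by a LOCALLY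
CONSTANT `γ̄ ∈ Γ_N^{(K)} = ker(GL_{2g}(ℤ/NK) → GL_{2g}(ℤ/N))` ([MumfordFogartyKirwan1994] p. 140), so that the two
classifying maps to `A_{g,δ,NK}` differ by the operator `T_γ̄` (★ `SiegelFineModuliScheme.classifyingMap_comp_classifyingMap_twist`)
member by member of an open cover.  HC_CM is proved only modulo the 7 printed citations until rung 0 closes; this file
discharges none of them (count-neutral capital).

SETTING.  `A/S` a COMMUTATIVE abelian scheme (`[IsCommMonObj A.X]`, the binder of ★ `LevelStructure.twist`), `N ≠ 0`,
`η₁ η₂ : LevelStructure g N A`; for the spreading statements `N` is invertible on `S` (`hN : ∀ t, (N : κ(t)) ≠ 0`, so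
that `A[N] → S` is finite étale, ★ `isFinite_fst_unit_pow_id` / `etale_fst_unit_pow_id`).  Matrices are named `gm` in
binders (`γ` is a notation token here).

* §1 `exists_twist_restrict_σ_eq` — AT A GEOMETRIC POINT `s`, `η₂.σᵢ(s) = (η₁·γ̄).σᵢ(s)` for some `γ̄ ∈ GL_{2g}(ℤ/N)`:
  both `a ↦ ηⱼ(a)(s)` are group isomorphisms `(ℤ/N)^{2g} ⥲ A_s[N](Ω)` (Def. 7.1 (i)), their quotient is an additive,
  hence `ℤ/N`-linear (Mathlib `AddMonoidHom.toZModLinearMap`), automorphism, i.e. a matrix (`LinearMap.toMatrix'`).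
* §2 `exists_isClopen_comp_left_eq_iff` — the locus where two `N`-torsion sections agree is OPEN AND CLOSED, with the
  test-morphism characterisation `x ≫ σ = x ≫ τ ↔ range x ⊆ U` (both are sections of the finite étale `A[N]`, ★
  `Morphisms.isClopen_range_sectionEqualizer`, as in ★ `TorsionPointsLocallyConstant`);
  `exists_isClopen_forall_comp_left_eq_twist_iff` — the locus `U_γ̄ = {η₂ = η₁·γ̄}`.
* §3 `exists_isClopen_cover_comp_left_eq_twist` — the `U_γ̄` COVER `S` (§1 at the geometric point over `t`).
* §4 **`exists_openCover_comp_left_eq_twist`** — the same as an OPEN COVER of `S` indexed by `GL_{2g}(ℤ/N)` with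
  `η₂.σᵢ = (η₁·γ̄).σᵢ` on the `γ̄`-th member (the shape consumed by Mathlib `Scheme.Cover.hom_ext`).
* §5 `twist_eq_one_of_restrict_σ_eq` — the twisting action is FREE on every geometric fibre;
  `map_eq_one_of_changeLevel_eq_of_restrict_σ_eq` — two refinements of the same level-`N₀` structure (`N = N₀ d`)
  differ by `γ̄ ≡ 1 (mod N₀)` (★ `changeLevel_twist`).

Mathlib searched (pin): `AddMonoidHom.toZModLinearMap`, `LinearMap.toMatrix'`, `Matrix.toLin'_toMatrix'`,
`Matrix.mulVec_single_one`, `isClopen_iInter_of_finite`, `Scheme.openCoverOfIsOpenCover` (all used).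

## References
* D. Mumford, J. Fogarty, F. Kirwan, *Geometric Invariant Theory*, 3rd ed. (1994), Ch. 7 §2 Definition 7.1 (p. 129); §3
  (pp. 139–140). [MumfordFogartyKirwan1994]
* U. Görtz, T. Wedhorn, *Algebraic Geometry II* (2023), Prop. 27.188 (1) (p. 675); Remark 18.30 and Prop. 18.29. [GortzWedhorn2023]
* U. Görtz, T. Wedhorn, *Algebraic Geometry I*, 2nd ed. (2020), Prop. 9.3 and Def./Prop. 9.7. [GortzWedhorn2020]
* P. Deligne, *Travaux de Shimura*, Sém. Bourbaki 389 (1971), 4.12 (b) p. 149. [Deligne1971TravauxShimura]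
-/

noncomputable section

universe u

open CategoryTheory Limits AlgebraicGeometry MonoidalCategory
open scoped MonObj Matrix

namespace Literature.AlgebraicGeometry.AbelianSchemes.AbelianSchemeOver.LevelStructure

open Literature.AlgebraicGeometry.Motives Literature.AlgebraicGeometry.Morphisms

variable {S : Scheme.{u}} {A : AbelianSchemeOver S} [IsCommMonObj A.X] {g N : ℕ} [NeZero N]
  (η₁ η₂ : LevelStructure g N A)

/-! ### §1 At a geometric point two level structures differ by a unique matrix -/

/-- **Two level-`N` structures differ by a matrix on every geometric fibre**: for `η₁, η₂` level-`N` structures on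
`A/S` and a geometric point `s`, there is `γ̄ ∈ GL_{2g}(ℤ/N)` with `η₂.σᵢ(s) = (η₁·γ̄).σᵢ(s)` for all `i` — both
`a ↦ η₁(a)(s)` and `a ↦ η₂(a)(s)` are group isomorphisms `(ℤ/N)^{2g} ⥲ A_s[N](Ω)` ([MumfordFogartyKirwan1994] Def. 7.1),
and their quotient is an additive, hence `ℤ/N`-linear, automorphism of `(ℤ/N)^{2g}`.
[cite: MumfordFogartyKirwan1994, Ch. 7 §2 Definition 7.1 (p. 129) and §3 (p. 139)] -/
theorem exists_twist_restrict_σ_eq {Ω : Type u} [Field Ω] [IsAlgClosed Ω] (s : Spec (.of Ω) ⟶ S) :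
    ∃ gm : GL (Fin g ⊕ Fin g) (ZMod N), ∀ i, A.restrict s (η₂.σ i) = A.restrict s ((η₁.twist gm).σ i) := by
  classical
  have htor : ∀ (φ : LevelStructure g N A) (a : Fin g ⊕ Fin g → ZMod N), A.restrict s (φ.section_ a) ^ N = 1 :=
    fun φ a => by rw [← A.restrict_pow s, LevelStructure.section_, A.sectionPow_pow_eq_one φ.pow_σ, A.restrict_one s]
  -- the transition functions `θ`, `θ'` on exponent vectors
  have hθ : ∀ a, ∃ b, A.restrict s (η₁.section_ b) = A.restrict s (η₂.section_ a) :=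
    fun a => η₁.basis_surjective s _ (htor η₂ a)
  have hθ' : ∀ b, ∃ a, A.restrict s (η₂.section_ a) = A.restrict s (η₁.section_ b) :=
    fun b => η₂.basis_surjective s _ (htor η₁ b)
  choose θ hθ using hθ
  choose θ' hθ' using hθ'
  have inj₁ : Function.Injective fun a => A.restrict s (η₁.section_ a) := η₁.basis_injective s
  have inj₂ : Function.Injective fun a => A.restrict s (η₂.section_ a) := η₂.basis_injective s
  have θ_add : ∀ a b, θ (a + b) = θ a + θ b := fun a b => inj₁ (by
    simp only [hθ, LevelStructure.section_add, A.restrict_mul s])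
  have θ'θ : ∀ a, θ' (θ a) = a := fun a => inj₂ (by simp only [hθ', hθ])
  have θθ' : ∀ b, θ (θ' b) = b := fun b => inj₁ (by simp only [hθ, hθ'])
  -- as `ℤ/N`-linear maps and matrices
  let θh : (Fin g ⊕ Fin g → ZMod N) →+ (Fin g ⊕ Fin g → ZMod N) :=
    { toFun := θ, map_zero' := by simpa using θ_add 0 0, map_add' := θ_add }
  have θ'_add : ∀ a b, θ' (a + b) = θ' a + θ' b := fun a b => by
    have h := θ_add (θ' a) (θ' b)
    rw [θθ', θθ'] at h
    rw [← θ'θ (θ' a + θ' b), h]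
  let θh' : (Fin g ⊕ Fin g → ZMod N) →+ (Fin g ⊕ Fin g → ZMod N) :=
    { toFun := θ', map_zero' := by simpa using θ'_add 0 0, map_add' := θ'_add }
  let L : (Fin g ⊕ Fin g → ZMod N) →ₗ[ZMod N] (Fin g ⊕ Fin g → ZMod N) := θh.toZModLinearMap N
  let L' : (Fin g ⊕ Fin g → ZMod N) →ₗ[ZMod N] (Fin g ⊕ Fin g → ZMod N) := θh'.toZModLinearMap N
  have hL : ∀ a, L a = θ a := fun a => rfl
  have hL' : ∀ a, L' a = θ' a := fun a => rfl
  have hLL' : L.comp L' = LinearMap.id := LinearMap.ext fun a => by simp [hL, hL', θθ']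
  have hL'L : L'.comp L = LinearMap.id := LinearMap.ext fun a => by simp [hL, hL', θ'θ]
  let gm : GL (Fin g ⊕ Fin g) (ZMod N) :=
    ⟨LinearMap.toMatrix' L, LinearMap.toMatrix' L',
      by rw [← LinearMap.toMatrix'_comp, hLL', LinearMap.toMatrix'_id],
      by rw [← LinearMap.toMatrix'_comp, hL'L, LinearMap.toMatrix'_id]⟩
  have hgm : ∀ a, (gm : Matrix (Fin g ⊕ Fin g) (Fin g ⊕ Fin g) (ZMod N)) *ᵥ a = θ a := fun a => by
    change LinearMap.toMatrix' L *ᵥ a = θ a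
    rw [← Matrix.toLin'_apply, Matrix.toLin'_toMatrix', hL]
  refine ⟨gm, fun i => ?_⟩
  rw [← LevelStructure.sectionPow_single η₂.pow_σ i, LevelStructure.twist_σ]
  have hcol : (fun j => (gm : Matrix (Fin g ⊕ Fin g) (Fin g ⊕ Fin g) (ZMod N)) j i) =
      (gm : Matrix (Fin g ⊕ Fin g) (Fin g ⊕ Fin g) (ZMod N)) *ᵥ Pi.single i 1 := by
    funext j
    rw [Matrix.mulVec_single_one, Matrix.col_apply]
  rw [hcol, hgm]
  exact (hθ (Pi.single i 1)).symm

/-! ### §2 The locus where two torsion sections agree is open and closed -/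

omit [NeZero N] in
/-- **The equality locus of two `N`-torsion sections is OPEN AND CLOSED** (`N` invertible on `S`): both factor through
the finite étale `A[N]` (★ `exists_torsion_subscheme`), where the equaliser of two sections is clopen (★
`Morphisms.isClopen_range_sectionEqualizer`); a test morphism `x : T → S` equalises the sections iff it lands in the locus.
[cite: MumfordFogartyKirwan1994, Ch. 7 §2 Definition 7.1 (p. 129)] [cite: GortzWedhorn2020, Prop. 9.3 and Def./Prop. 9.7] -/
theorem exists_isClopen_comp_left_eq_iff (hN : ∀ t : S, (N : S.residueField t) ≠ 0) (σ τ : A.Sections)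
    (hσ : σ ^ N = 1) (hτ : τ ^ N = 1) :
    ∃ U : Set S, IsClopen U ∧ ∀ {T : Scheme.{u}} (x : T ⟶ S), x ≫ σ.left = x ≫ τ.left ↔ Set.range x ⊆ U := by
  -- the finite étale `q : A[N] → S` (as in ★ `TorsionPointsLocallyConstant`) and the two sections `σ`, `τ` define
  let nN : A.X ⟶ A.X := (𝟙 A.X : A.X ⟶ A.X) ^ N
  let q := pullback.fst (η[A.X] : 𝟙_ (Over S) ⟶ A.X).left nN.left
  haveI : IsFinite q := A.isFinite_fst_unit_pow_id hN
  haveI : Etale q := A.etale_fst_unit_pow_id hN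
  have hσN : σ.left ≫ nN.left = (η[A.X] : 𝟙_ (Over S) ⟶ A.X).left := A.comp_pow_id_left_eq_of_pow_eq_one hσ
  have hτN : τ.left ≫ nN.left = (η[A.X] : 𝟙_ (Over S) ⟶ A.X).left := A.comp_pow_id_left_eq_of_pow_eq_one hτ
  let sσ : S ⟶ pullback (η[A.X] : 𝟙_ (Over S) ⟶ A.X).left nN.left :=
    pullback.lift (𝟙 S) σ.left ((Category.id_comp _).trans hσN.symm)
  let sτ : S ⟶ pullback (η[A.X] : 𝟙_ (Over S) ⟶ A.X).left nN.left :=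
    pullback.lift (𝟙 S) τ.left ((Category.id_comp _).trans hτN.symm)
  have w : sσ ≫ q = sτ ≫ q := by simp only [sσ, sτ, q, pullback.lift_fst]
  have e1 : sσ ≫ pullback.snd (η[A.X] : 𝟙_ (Over S) ⟶ A.X).left nN.left = σ.left := pullback.lift_snd _ _ _
  have e2 : sτ ≫ pullback.snd (η[A.X] : 𝟙_ (Over S) ⟶ A.X).left nN.left = τ.left := pullback.lift_snd _ _ _
  refine ⟨_, isClopen_range_sectionEqualizer (q := q) w, fun x => Iff.trans ?_
    (comp_eq_comp_iff_range_subset_sectionEqualizer (q := q) w x)⟩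
  constructor
  · intro h
    apply pullback.hom_ext
    · change x ≫ sσ ≫ q = x ≫ sτ ≫ q
      rw [w]
    · change x ≫ sσ ≫ pullback.snd (η[A.X] : 𝟙_ (Over S) ⟶ A.X).left nN.left =
        x ≫ sτ ≫ pullback.snd (η[A.X] : 𝟙_ (Over S) ⟶ A.X).left nN.left
      rw [e1, e2]
      exact h
  · intro h
    have h1 := congrArg (· ≫ pullback.snd (η[A.X] : 𝟙_ (Over S) ⟶ A.X).left nN.left) h
    simp only [Category.assoc] at h1
    erw [e1, e2] at h1
    exact h1

/-- **The locus where `η₂ = η₁·γ̄` is open and closed**, with its test-morphism characterisation.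
[cite: MumfordFogartyKirwan1994, Ch. 7 §2 Definition 7.1 (p. 129) and §3 (p. 139)] [cite: GortzWedhorn2020, Prop. 9.3 and Def./Prop. 9.7] -/
theorem exists_isClopen_forall_comp_left_eq_twist_iff (hN : ∀ t : S, (N : S.residueField t) ≠ 0)
    (gm : GL (Fin g ⊕ Fin g) (ZMod N)) :
    ∃ U : Set S, IsClopen U ∧ ∀ {T : Scheme.{u}} (x : T ⟶ S),
      (∀ i, x ≫ (η₂.σ i).left = x ≫ ((η₁.twist gm).σ i).left) ↔ Set.range x ⊆ U := by
  have h := fun i => exists_isClopen_comp_left_eq_iff (A := A) hN (η₂.σ i) ((η₁.twist gm).σ i) (η₂.pow_σ i)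
    ((η₁.twist gm).pow_σ i)
  choose U hU hiff using h
  refine ⟨⋂ i, U i, isClopen_iInter_of_finite hU, fun x => ?_⟩
  rw [Set.subset_iInter_iff]
  exact forall_congr' fun i => hiff i x

/-! ### §3 The loci cover the base -/

/-- **TWO LEVEL STRUCTURES DIFFER BY A LOCALLY CONSTANT MATRIX**: there are clopen loci `U_γ̄ ⊆ S`,
`γ̄ ∈ GL_{2g}(ℤ/N)`, COVERING `S`, such that a test morphism `x : T → S` lands in `U_γ̄` iff `η₂ = η₁·γ̄` after `x`
(section by section: `x ≫ η₂.σᵢ = x ≫ (η₁·γ̄).σᵢ`).  (The loci are the equalisers of §2; they cover `S` because at the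
geometric point over any `t ∈ S` the two bases differ by some `γ̄`, §1.)  [MumfordFogartyKirwan1994] Ch. 7 §3 p. 140:
«`Γ_n` acts on `ℋ_{g,d,n}`» freely and transitively on the level structures of a fixed fibre, continuously in families.
[cite: MumfordFogartyKirwan1994, Ch. 7 §2 Definition 7.1 (p. 129) and §3 (p. 139)] [cite: GortzWedhorn2023, Prop. 27.188 (1) (p. 675)] -/
theorem exists_isClopen_cover_comp_left_eq_twist (hN : ∀ t : S, (N : S.residueField t) ≠ 0) :
    ∃ U : GL (Fin g ⊕ Fin g) (ZMod N) → Set S, (∀ gm, IsClopen (U gm)) ∧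
      (∀ gm {T : Scheme.{u}} (x : T ⟶ S),
        (∀ i, x ≫ (η₂.σ i).left = x ≫ ((η₁.twist gm).σ i).left) ↔ Set.range x ⊆ U gm) ∧
      ∀ t : S, ∃ gm, t ∈ U gm := by
  have h := fun gm => exists_isClopen_forall_comp_left_eq_twist_iff η₁ η₂ hN gm
  choose U hU hiff using h
  refine ⟨U, hU, fun gm _ x => hiff gm x, fun t => ?_⟩
  -- the geometric point over `t`
  let Ω : Type u := AlgebraicClosure (S.residueField t)
  let sbar : Spec (.of Ω) ⟶ S :=
    Spec.map (CommRingCat.ofHom (algebraMap (S.residueField t) Ω)) ≫ S.fromSpecResidueField t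
  obtain ⟨gm, hgm⟩ := exists_twist_restrict_σ_eq η₁ η₂ sbar
  refine ⟨gm, ?_⟩
  have hsb : ∀ i, sbar ≫ (η₂.σ i).left = sbar ≫ ((η₁.twist gm).σ i).left := fun i => by
    have h := congrArg Over.Hom.left (hgm i)
    rw [restrict_left, restrict_left] at h
    exact h
  have hsub := (hiff gm sbar).1 hsb
  have hpt : sbar.base (IsLocalRing.closedPoint Ω) = t := by
    simp only [sbar, Scheme.Hom.comp_base, TopCat.comp_app]
    exact Scheme.fromSpecResidueField_apply _ _
  rw [← hpt]
  exact hsub ⟨_, rfl⟩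

/-! ### §4 As an open cover -/

/-- **THE OPEN COVER ON WHICH `η₂ = η₁·γ̄`**: an open cover of `S` indexed by `GL_{2g}(ℤ/N)` (members the clopen loci
of §3, possibly empty) on whose `γ̄`-th member `η₂.σᵢ = (η₁·γ̄).σᵢ` for all `i` — the shape consumed when two
morphisms out of `S` are compared member by member (Mathlib `Scheme.Cover.hom_ext`).
[cite: MumfordFogartyKirwan1994, Ch. 7 §2 Definition 7.1 (p. 129) and §3 (pp. 139–140)] [cite: GortzWedhorn2023, Prop. 27.188 (1) (p. 675)] -/
theorem exists_openCover_comp_left_eq_twist (hN : ∀ t : S, (N : S.residueField t) ≠ 0) :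
    ∃ (𝒰 : Scheme.OpenCover.{0} S) (gm : 𝒰.I₀ → GL (Fin g ⊕ Fin g) (ZMod N)),
      ∀ j i, 𝒰.f j ≫ (η₂.σ i).left = 𝒰.f j ≫ ((η₁.twist (gm j)).σ i).left := by
  obtain ⟨U, hU, hiff, hcov⟩ := exists_isClopen_cover_comp_left_eq_twist η₁ η₂ hN
  let V : GL (Fin g ⊕ Fin g) (ZMod N) → S.Opens := fun gm => ⟨U gm, (hU gm).isOpen⟩
  have hV : TopologicalSpace.IsOpenCover V := by
    rw [TopologicalSpace.IsOpenCover, eq_top_iff]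
    rintro t -
    obtain ⟨gm, ht⟩ := hcov t
    exact TopologicalSpace.Opens.mem_iSup.mpr ⟨gm, ht⟩
  refine ⟨S.openCoverOfIsOpenCover V hV, fun gm => gm, fun gm i => ?_⟩
  refine ((hiff gm (V gm).ι).2 ?_) i
  rw [Scheme.Opens.range_ι]
  exact subset_rfl

/-! ### §5 Refinements of a common level structure differ by a matrix `≡ 1` -/

/-- **The twisting action is free on every geometric fibre**: if `(φ·γ̄).σᵢ(s) = φ.σᵢ(s)` for all `i` at ONE geometric
point `s`, then `γ̄ = 1` (the `φ.σᵢ(s)` form a basis of `A_s[N](Ω)`). [cite: MumfordFogartyKirwan1994, Ch. 7 §2 Definition 7.1 (p. 129) and §3 (p. 140)] -/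
theorem twist_eq_one_of_restrict_σ_eq (φ : LevelStructure g N A) (gm : GL (Fin g ⊕ Fin g) (ZMod N))
    {Ω : Type u} [Field Ω] [IsAlgClosed Ω] (s : Spec (.of Ω) ⟶ S)
    (h : ∀ i, A.restrict s ((φ.twist gm).σ i) = A.restrict s (φ.σ i)) : gm = 1 := by
  refine Units.ext (Matrix.ext fun j i => ?_)
  have hi := h i
  rw [twist_σ, ← LevelStructure.sectionPow_single φ.pow_σ i] at hi
  have hinj := φ.basis_injective s hi
  have hji := congrFun hinj j
  rw [Units.val_one, Matrix.one_apply, hji, Pi.single_apply]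

/-- **TWO REFINEMENTS OF THE SAME LEVEL STRUCTURE DIFFER BY A MATRIX `≡ 1 (mod N₀)`**: if `N = N₀·d` and
`η₁`, `η₂` induce the same level-`N₀` structure (`η₁.changeLevel = η₂.changeLevel`), then at a geometric point `s` where
`η₂.σᵢ(s) = (η₁·γ̄).σᵢ(s)` for all `i`, the reduction of `γ̄` mod `N₀` is `1` — i.e. `γ̄ ∈ Γ_{N₀}^{(d)} =
ker(GL_{2g}(ℤ/N) → GL_{2g}(ℤ/N₀))`, [MumfordFogartyKirwan1994] p. 140 (★ `changeLevel_twist` + freeness).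
[cite: MumfordFogartyKirwan1994, Ch. 7 §3 (pp. 139–140)] [cite: Deligne1971TravauxShimura, 4.12 (b) p. 149] -/
theorem map_eq_one_of_changeLevel_eq_of_restrict_σ_eq {N₀ d : ℕ} [NeZero N₀] (hd : N = N₀ * d)
    (hη : η₁.changeLevel N₀ d hd (NeZero.ne N) = η₂.changeLevel N₀ d hd (NeZero.ne N))
    (gm : GL (Fin g ⊕ Fin g) (ZMod N)) {Ω : Type u} [Field Ω] [IsAlgClosed Ω] (s : Spec (.of Ω) ⟶ S)
    (h : ∀ i, A.restrict s (η₂.σ i) = A.restrict s ((η₁.twist gm).σ i)) :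
    Matrix.GeneralLinearGroup.map (ZMod.castHom (⟨d, hd⟩ : N₀ ∣ N) (ZMod N₀)) gm = 1 := by
  refine twist_eq_one_of_restrict_σ_eq (η₁.changeLevel N₀ d hd (NeZero.ne N)) _ s fun i => ?_
  rw [← changeLevel_twist, hη, changeLevel_σ, changeLevel_σ, A.restrict_pow s, A.restrict_pow s, h i]

end Literature.AlgebraicGeometry.AbelianSchemes.AbelianSchemeOver.LevelStructure

end
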